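import Summits.QuantumFields.YangMills.Theorems.BalabanUVNodesN15CurvedGluingCubeSpecies
import Summits.QuantumFields.YangMills.Theorems.BalabanUVNodesN15CurvedGluingSpeciesCommutatorDefect
import HarnessLib

/-!
# Route «BalabanUVNodes» (cluster K4 «SpineRates»), Track-A DAG node N15 = NE2, BACKGROUND LAYER — THE SPECIES OF A DIRICHLET CUBE, II: ENTRIES 1 `∇^±_μ∘G_□(Δ − V)` OF THE CUBE PROPAGATOR AT
# A LIVE BACKGROUND from the flat cube resolvent's entries and the species letters (the left derivative rows dag-n15-c's FILE 46 ∕ FILE 55 bundle display as `hD`, `hDb`)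

Cell `pub-ymgap`, seat `pub-ymgap-dag-n15-w3` (WIDTH SEAT 3∕3 on node N15, director-ym №197 ∕ HUMAN RULING D-0149; plan `W-SEAT-START-LIST.md` §n15 item 3 — seventeenth piece, the successor
half of file 16's device).  `bears_on: R4∕N15 · K3⁷ SpineGivenEndpointR13SepCoPH (stmt-QuantumFields-20544)`.  Filed `--kind proof --supports stmt-QuantumFields-20544 --as helper` — COUNT-NEUTRAL.
Theorems only; 0 `sorry`.  Imports BY NAME file 16 `…N15CurvedGluingCubeSpecies` (`cubeRes`, `cmprA`, `cmprC`, `cubeInv_sub_speciesOpM_eq`, `fgrad_comp_dressed`, `bgrad_comp_dressed`,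
`hasMaj_bgPairM_cmpr`; through it dag-n15-c FILE 47 `cubeInv`∕`dirOp`∕`hasMaj_localize`∕`sandwich_in_out`, FILE 48 `fgrad_comp_mulOp`∕`bgrad_comp_mulOp`, FILE 45 `hasMaj_diag_comp`∕`hasMaj_comp_diag`, M1
`bgPairM`∕`projO`∕`hasMaj_projO_comp`, lit `T4EtaRateCoeffDefect.hasMaj_mulOp`); nothing in the tree is modified.

WHY.  File 16 identified dag-n15-c's Dirichlet cube propagator at a live background with M1's dressed pair around the flat cube resolvent, `G_□(Δ − V) = M_χ∘pr₀X̂∘M_χ`, and read its ENTRY 0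
off the flat resolvent's entries.  The gluing's remainder rows ((2.134), FILE 46 `hasMaj_commOp_lapOp_comp`, FILE 52 `hasMaj_commOp_covLapM_comp`) and my species rows (files 12–15) need the
cube's ENTRIES 1 as well: `∇^±_μ∘G_□ ≤ 1_S1_S·β₁e^{−δd}`.  THIS FILE: by the lattice Leibniz rule `∇⁺∘M_χ = M_{χ∘τ}∘∇⁺ + M_{∇⁺χ}` (FILE 48) and file 16's `∇⁺∘pr₀X̂ = pr_{⁺μ}X̂` (the pair's derivative
component IS the quotient of the dressed propagator), `∇⁺_μ∘G_□(Δ − V) = M_{χ∘τ_μ}∘pr_{⁺μ}X̂∘M_χ + M_{∇⁺_μχ}∘pr₀X̂∘M_χ` EXACTLY — two sandwiches of components of ONE pair, each localized from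
supports (FILE 47 `sandwich_in_out` + `hasMaj_localize`) — so `∇^±_μ∘G_□(Δ − V) ≤ 1_S(y)1_S(y′)·(1 + c_χ)·β(1 − βRc_r)⁻¹·e^{−ρd}` with the SAME letters as entry 0 (`c_χ = |∇^±χ|`, the cut-off's
quotient; `S` ⊇ the blocks of `supp χ ∪ supp χ∘τ^{±1}`).

* §1 ★ `fgrad_comp_cubeInv_sub_speciesOpM_eq`, ★ `bgrad_comp_cubeInv_sub_speciesOpM_eq` (exact);
* §2 `hasMaj_sandwich_localize` (one sandwich `M_ψ∘T∘M_χ` of a majorised `T` with `|ψ| ≤ c`, `|χ| ≤ 1`, both supported over `S`: `≤ 1_S1_S·c·K`), ★★ `hasMaj_fgrad_comp_cubeInv_sub_speciesOpM`, ★★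
  `hasMaj_bgrad_comp_cubeInv_sub_speciesOpM`;
* §3 BY NAME AT BAŁABAN's OPERATOR: `covLapM_add_eq_lapOp_sub` (`Δ_U + W = lapOp η⁻¹ (liftEquiv∘τ) W − V(c_U, a_U)`, file 13 `covLapM_eq_lapOp`), ★★★ `hasMaj_cubeInv_covLapM_add` and ★★
  `hasMaj_fgrad_comp_cubeInv_covLapM_add` ∕ `hasMaj_bgrad_comp_cubeInv_covLapM_add` — the ENTRIES 0∕1 of dag-n15-c's cube propagator `cubeInv (Δ_U + W) χ` of the covariant Laplacian (3.50)
  (plus any further summand `W`: `Q*aQ`, `DRD*`, masses) AT A LIVE BACKGROUND `U` from the entries of the FLAT cube resolvent `cubeRes (lapOp η⁻¹ (liftEquiv∘τ) W) χ` and the transport rows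
  `Σ_k|a_U{}^±(x)_{ik}| ≤ r_a`, `Σ_k|c_U(x)_{ik}| ≤ r_c` (`a_U = tCoefA η U`, `c_U = tCoefC η U` — the (3.35)–(3.37)-shaped letters) — the per-cube rows `hG`, `hD`, `hDb` of FILE 55's bundle at one
  grid.

HONEST FRAMING ∕ LIMITS.  As file 16: finite-dimensional algebra + B1a's Neumann series over DISPLAYED flat cube entries `N_□, ∇^±N_□ ≤ βe^{−δd}`, species letters, cut-off letters, the two
unit hypotheses; ONE grid (no η-defect — file 16's boundary-layer caveat); file 16's REGIME CAVEAT applies verbatim (sharp cut-off ⇒ `c_χ = η⁻¹` on the boundary layer ⇒ the crude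
smallness `βRc_r < 1` is not the print's regime; the print-compatible step-majorant ∕ boundary-letter edition is the successor); the RIGHT entries `G_□∘∇^±` (adjoint arrangement) are NOT
here; nothing of [B6]∕[B9] asserted ((2.133) p. 247,
(3.62)–(3.65) pp. 402–403 = SHAPES ∕ MECHANISM).  NE2⁺ NOT PRINTED, NOT proved; N15 NOT discharged; counts of record UNMOVED (typed 28∕28 · discharged 5∕27); one finite 𝕋⁴ at fixed ε — NOT
infinite volume, NOT OS on ℝ⁴, NOT a mass gap, NOT Clay; R4 closes the conditional finite-𝕋⁴ rung `BalabanLadder.UV` only.  Restate-immune (no Theses import).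
-/

set_option autoImplicit false

noncomputable section
open scoped BigOperators
open Finset

namespace Summit.QuantumFields.YangMills.BalabanUVNodes.N15.CurvedSpecies

open Literature.MathematicalPhysics.QuantumFieldTheory.Balaban1983to89
open Literature.MathematicalPhysics.QuantumFieldTheory.Balaban1983to89.B11SectG (BlockNorm HasMaj RowSum)
open Literature.MathematicalPhysics.QuantumFieldTheory.Balaban1983to89.T4EtaRateCoeffDefect (diagK diagK_nonneg hasMaj_mulOp)
open Literature.MathematicalPhysics.QuantumFieldTheory.Balaban1983to89.B6RandomWalk (Triangle254)
open Literature.MathematicalPhysics.QuantumFieldTheory.Balaban1983to89.B6Prop26Gluing (mulOp mulOp_apply ind ind_nonneg)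
open Summit.QuantumFields.YangMills.BalabanUVNodes.N15.MatrixSpecies (mmulOp liftBlk liftEquiv liftEquiv_apply liftEquiv_symm_apply)
open Summit.QuantumFields.YangMills.BalabanUVNodes.N15.BackgroundLayer (fgrad bgrad fgrad_apply bgrad_apply speciesOpM stack projO blkPair hasMaj_projO_comp unstackM bgPairM covLapM tCoefA tCoefC)
open Summit.QuantumFields.YangMills.BalabanUVNodes.N15.Gluing (dirOp cubeInv lapOp hasMaj_localize sandwich_in_out hasMaj_diag_comp hasMaj_comp_diag fgrad_comp_mulOp bgrad_comp_mulOp)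

variable {X ι J : Type} [Fintype X] [DecidableEq X] [Fintype ι] [DecidableEq ι] [Fintype J] [DecidableEq J] {g : B6.Geometry} (blk : X → g.Site)
  (τ : J → X ≃ X) (n : ℝ) (χX : X → ℝ) (C : X → Matrix ι ι ℝ) (A : J ⊕ J → X → Matrix ι ι ℝ) (Δ : (X × ι → ℝ) →ₗ[ℝ] (X × ι → ℝ)) {σ cr : ℝ}

/-! ## §1 The derivative entries of the cube propagator, exactly -/

section Exact

/-- ★ `∇⁺_μ∘G_□(Δ − V) = M_{χ∘τ_μ}∘pr_{⁺μ}X̂∘M_χ + M_{∇⁺_μχ}∘pr₀X̂∘M_χ` — FILE 48's Leibniz rule through the left cut-off and file 16's identification of the pair's derivative component.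
[cite: Balaban1984PropagatorsI, (1.2)–(1.3) p.18 (shape); Balaban1985BackgroundPropagators, (3.64) p.403 (mechanism)] -/
theorem fgrad_comp_cubeInv_sub_speciesOpM_eq (hunit₀ : IsUnit (LinearMap.toMatrix' (dirOp Δ (fun p : X × ι => χX p.1))))
    (hunit : IsUnit (1 - LinearMap.toMatrix' (stack (cubeRes Δ (fun p : X × ι => χX p.1))
      (Sum.elim (fun μ => fgrad n (liftEquiv (τ μ) ι) ∘ₗ cubeRes Δ (fun p : X × ι => χX p.1)) (fun μ => bgrad n (liftEquiv (τ μ) ι) ∘ₗ cubeRes Δ (fun p : X × ι => χX p.1))) ∘ₗ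
      unstackM (cmprC τ n χX C A) (cmprA τ χX A)))) (μ : J) :
    fgrad n (liftEquiv (τ μ) ι) ∘ₗ cubeInv (Δ - speciesOpM τ n C A) (fun p : X × ι => χX p.1) =
      mulOp ((fun p : X × ι => χX p.1) ∘ ⇑(liftEquiv (τ μ) ι)) ∘ₗ
          (projO (some (Sum.inl μ)) ∘ₗ bgPairM (cubeRes Δ (fun p : X × ι => χX p.1))
            (Sum.elim (fun μ => fgrad n (liftEquiv (τ μ) ι) ∘ₗ cubeRes Δ (fun p : X × ι => χX p.1)) (fun μ => bgrad n (liftEquiv (τ μ) ι) ∘ₗ cubeRes Δ (fun p : X × ι => χX p.1)))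
            (cmprC τ n χX C A) (cmprA τ χX A)) ∘ₗ mulOp (fun p : X × ι => χX p.1) +
        mulOp (fgrad n (liftEquiv (τ μ) ι) (fun p : X × ι => χX p.1)) ∘ₗ
          (projO none ∘ₗ bgPairM (cubeRes Δ (fun p : X × ι => χX p.1))
            (Sum.elim (fun μ => fgrad n (liftEquiv (τ μ) ι) ∘ₗ cubeRes Δ (fun p : X × ι => χX p.1)) (fun μ => bgrad n (liftEquiv (τ μ) ι) ∘ₗ cubeRes Δ (fun p : X × ι => χX p.1)))
            (cmprC τ n χX C A) (cmprA τ χX A)) ∘ₗ mulOp (fun p : X × ι => χX p.1) := by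
  rw [cubeInv_sub_speciesOpM_eq τ n C A χX Δ hunit₀ rfl (fun _ => rfl) (fun _ => rfl) hunit, ← LinearMap.comp_assoc, fgrad_comp_mulOp, LinearMap.add_comp, LinearMap.comp_assoc,
    ← LinearMap.comp_assoc (mulOp _) (projO none ∘ₗ _) (fgrad n _), fgrad_comp_dressed τ n (cmprC τ n χX C A) (cmprA τ χX A) (fun _ => rfl) hunit μ]

/-- ★ `∇⁻_μ∘G_□(Δ − V) = M_{χ∘τ_μ⁻¹}∘pr_{⁻μ}X̂∘M_χ + M_{∇⁻_μχ}∘pr₀X̂∘M_χ`. [cite: Balaban1984PropagatorsI, (1.2)–(1.3) p.18 (shape); Balaban1985BackgroundPropagators, (3.64) p.403 (mechanism)] -/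
theorem bgrad_comp_cubeInv_sub_speciesOpM_eq (hunit₀ : IsUnit (LinearMap.toMatrix' (dirOp Δ (fun p : X × ι => χX p.1))))
    (hunit : IsUnit (1 - LinearMap.toMatrix' (stack (cubeRes Δ (fun p : X × ι => χX p.1))
      (Sum.elim (fun μ => fgrad n (liftEquiv (τ μ) ι) ∘ₗ cubeRes Δ (fun p : X × ι => χX p.1)) (fun μ => bgrad n (liftEquiv (τ μ) ι) ∘ₗ cubeRes Δ (fun p : X × ι => χX p.1))) ∘ₗ
      unstackM (cmprC τ n χX C A) (cmprA τ χX A)))) (μ : J) :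
    bgrad n (liftEquiv (τ μ) ι) ∘ₗ cubeInv (Δ - speciesOpM τ n C A) (fun p : X × ι => χX p.1) =
      mulOp ((fun p : X × ι => χX p.1) ∘ ⇑(liftEquiv (τ μ) ι).symm) ∘ₗ
          (projO (some (Sum.inr μ)) ∘ₗ bgPairM (cubeRes Δ (fun p : X × ι => χX p.1))
            (Sum.elim (fun μ => fgrad n (liftEquiv (τ μ) ι) ∘ₗ cubeRes Δ (fun p : X × ι => χX p.1)) (fun μ => bgrad n (liftEquiv (τ μ) ι) ∘ₗ cubeRes Δ (fun p : X × ι => χX p.1)))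
            (cmprC τ n χX C A) (cmprA τ χX A)) ∘ₗ mulOp (fun p : X × ι => χX p.1) +
        mulOp (bgrad n (liftEquiv (τ μ) ι) (fun p : X × ι => χX p.1)) ∘ₗ
          (projO none ∘ₗ bgPairM (cubeRes Δ (fun p : X × ι => χX p.1))
            (Sum.elim (fun μ => fgrad n (liftEquiv (τ μ) ι) ∘ₗ cubeRes Δ (fun p : X × ι => χX p.1)) (fun μ => bgrad n (liftEquiv (τ μ) ι) ∘ₗ cubeRes Δ (fun p : X × ι => χX p.1)))
            (cmprC τ n χX C A) (cmprA τ χX A)) ∘ₗ mulOp (fun p : X × ι => χX p.1) := by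
  rw [cubeInv_sub_speciesOpM_eq τ n C A χX Δ hunit₀ rfl (fun _ => rfl) (fun _ => rfl) hunit, ← LinearMap.comp_assoc, bgrad_comp_mulOp, LinearMap.add_comp, LinearMap.comp_assoc,
    ← LinearMap.comp_assoc (mulOp _) (projO none ∘ₗ _) (bgrad n _), bgrad_comp_dressed τ n (cmprC τ n χX C A) (cmprA τ χX A) (fun _ => rfl) hunit μ]

end Exact

/-! ## §2 The localized majorants of the derivative entries -/

section Rows

omit [DecidableEq X] [DecidableEq ι] [Fintype J] [DecidableEq J] in
/-- ONE SANDWICH, LOCALIZED: `T ≤ K` (`K ≥ 0`), `|ψ| ≤ c`, `|χ| ≤ 1`, both cut-offs supported over `S` ⟹ `M_ψ∘T∘M_χ ≤ 1_S(y)1_S(y′)·c·K(y,y′)` (diagonal factors cost nothing; FILE 47 `sandwich_in_out` +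
`hasMaj_localize`). [cite: Balaban1984PropagatorsII, (2.133) p.247 («for y, y′ ∈ 𝔅 ∩ T_□»: shape)] -/
theorem hasMaj_sandwich_localize {T : (X × ι → ℝ) →ₗ[ℝ] (X × ι → ℝ)} {ψ χ : X × ι → ℝ} {S : Set g.Site} {K : g.Site → g.Site → ℝ} {c : ℝ} (hK : ∀ a b, 0 ≤ K a b) (hc : 0 ≤ c)
    (hψ : ∀ p, |ψ p| ≤ c) (hχ : ∀ p, |χ p| ≤ 1) (hSψ : ∀ p, ψ p ≠ 0 → blk p.1 ∈ S) (hSχ : ∀ p, χ p ≠ 0 → blk p.1 ∈ S)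
    (hT : HasMaj (BlockNorm.ofBlocks g (liftBlk blk ι)) (BlockNorm.ofBlocks g (liftBlk blk ι)) T K) :
    HasMaj (BlockNorm.ofBlocks g (liftBlk blk ι)) (BlockNorm.ofBlocks g (liftBlk blk ι)) (mulOp ψ ∘ₗ T ∘ₗ mulOp χ) (fun y y' => ind S y * ind S y' * (c * K y y')) := by
  have hMψ := hasMaj_mulOp (g := g) (liftBlk blk ι) (m := fun _ => c) (fun _ => hc) hψ
  have hMχ := hasMaj_mulOp (g := g) (liftBlk blk ι) (m := fun _ => (1 : ℝ)) (fun _ => zero_le_one) hχ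
  have h := hasMaj_diag_comp (liftBlk blk ι) (fun _ => hc) hMψ (hasMaj_comp_diag (liftBlk blk ι) hK hT hMχ)
  obtain ⟨hout, hin⟩ := sandwich_in_out (liftBlk blk ι) (liftBlk blk ι) (T := T) (χ₁ := χ) (χ₂ := ψ) hSχ hSψ
  refine (hasMaj_localize (liftBlk blk ι) (liftBlk blk ι) (fun a b => mul_nonneg hc (mul_nonneg (hK a b) zero_le_one)) hout hin h).mono fun y y' => le_of_eq ?_
  ring

/-- ★★ **ENTRY 1 (forward) OF THE CUBE PROPAGATOR AT A LIVE BACKGROUND**: under file 16's data (flat cube resolvent entries `N_□, ∇^±N_□ ≤ βe^{−δd}`, idempotent ι-constant cut-off with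
`|χ_X| ≤ 1`, `|∇^±χ_X| ≤ c_χ`, `supp χ_X ∪ supp χ_X∘τ_μ` over `S`, species letters `r_c, r_a`, `R = (r_c + r_a + 2|J|c_χr_a)(1 + |J ⊕ J|)`, `ρ + σ ≤ δ`, `βRc_r < 1`):
`∇⁺_μ∘cubeInv (Δ − V(c, a)) χ ≤ 1_S(y)1_S(y′)·(1 + c_χ)·β(1 − βRc_r)⁻¹·e^{−ρd}`. [cite: Balaban1984PropagatorsII, (2.133) p.247 («|(∇G_□J)(x)|»: shape); Balaban1985BackgroundPropagators, p.399, (3.62)–(3.65) pp.402–403 (mechanism)] -/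
theorem hasMaj_fgrad_comp_cubeInv_sub_speciesOpM (htri : Triangle254 g) (hd : ∀ a b : g.Site, 0 ≤ g.dist a b) (hrow : RowSum g σ cr) (hσ : 0 ≤ σ) {ρ δ β rC rA cχ : ℝ}
    (hρ : 0 ≤ ρ) (hρδ : ρ + σ ≤ δ) (hβ : 0 ≤ β) (hrC : 0 ≤ rC) (hrA : 0 ≤ rA) (hcχ : 0 ≤ cχ) {S : Set g.Site} (hχ : ∀ x, |χX x| ≤ 1)
    (hdχ : ∀ μ x, |fgrad n (τ μ) χX x| ≤ cχ) (hdχb : ∀ μ x, |bgrad n (τ μ) χX x| ≤ cχ) (hS : ∀ x, χX x ≠ 0 → blk x ∈ S) (μ : J) (hSτ : ∀ x, χX (τ μ x) ≠ 0 → blk x ∈ S)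
    (hC : ∀ x i, ∑ k, |C x i k| ≤ rC) (hA : ∀ j x i, ∑ k, |A j x i k| ≤ rA) (hunit₀ : IsUnit (LinearMap.toMatrix' (dirOp Δ (fun p : X × ι => χX p.1))))
    (hN : HasMaj (BlockNorm.ofBlocks g (liftBlk blk ι)) (BlockNorm.ofBlocks g (liftBlk blk ι)) (cubeRes Δ (fun p : X × ι => χX p.1)) (fun y y' => β * Real.exp (-(δ * g.dist y y'))))
    (hDN : ∀ μ, HasMaj (BlockNorm.ofBlocks g (liftBlk blk ι)) (BlockNorm.ofBlocks g (liftBlk blk ι)) (fgrad n (liftEquiv (τ μ) ι) ∘ₗ cubeRes Δ (fun p : X × ι => χX p.1))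
      (fun y y' => β * Real.exp (-(δ * g.dist y y'))))
    (hDNb : ∀ μ, HasMaj (BlockNorm.ofBlocks g (liftBlk blk ι)) (BlockNorm.ofBlocks g (liftBlk blk ι)) (bgrad n (liftEquiv (τ μ) ι) ∘ₗ cubeRes Δ (fun p : X × ι => χX p.1))
      (fun y y' => β * Real.exp (-(δ * g.dist y y'))))
    (hq : β * ((rC + rA + Fintype.card J * (2 * (cχ * rA))) * (1 + Fintype.card (J ⊕ J))) * cr < 1) :
    HasMaj (BlockNorm.ofBlocks g (liftBlk blk ι)) (BlockNorm.ofBlocks g (liftBlk blk ι)) (fgrad n (liftEquiv (τ μ) ι) ∘ₗ cubeInv (Δ - speciesOpM τ n C A) (fun p : X × ι => χX p.1))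
      (fun y y' => ind S y * ind S y' * ((1 + cχ) * (β * (1 - β * ((rC + rA + Fintype.card J * (2 * (cχ * rA))) * (1 + Fintype.card (J ⊕ J))) * cr)⁻¹) * Real.exp (-(ρ * g.dist y y')))) := by
  obtain ⟨hunit, hX⟩ := hasMaj_bgPairM_cmpr blk τ n χX C A Δ htri hd hrow hσ hρ hρδ hβ hrC hrA hcχ hχ hdχ hdχb hC hA hN hDN hDNb hq
  have hβX : 0 ≤ β * (1 - β * ((rC + rA + Fintype.card J * (2 * (cχ * rA))) * (1 + Fintype.card (J ⊕ J))) * cr)⁻¹ :=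
    mul_nonneg hβ (inv_nonneg.2 (by linarith))
  have hK : ∀ a b : g.Site, 0 ≤ β * (1 - β * ((rC + rA + Fintype.card J * (2 * (cχ * rA))) * (1 + Fintype.card (J ⊕ J))) * cr)⁻¹ * Real.exp (-(ρ * g.dist a b)) :=
    fun a b => mul_nonneg hβX (Real.exp_nonneg _)
  have hχp : ∀ p : X × ι, |(fun p : X × ι => χX p.1) p| ≤ 1 := fun p => hχ p.1
  have hSp : ∀ p : X × ι, (fun p : X × ι => χX p.1) p ≠ 0 → blk p.1 ∈ S := fun p hp => hS p.1 hp
  -- the two sandwiches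
  have t1 := hasMaj_sandwich_localize blk (ψ := (fun p : X × ι => χX p.1) ∘ ⇑(liftEquiv (τ μ) ι)) hK zero_le_one
    (fun p => by simpa only [Function.comp_apply, liftEquiv_apply] using hχ (τ μ p.1)) hχp
    (fun p hp => hSτ p.1 (by simpa only [Function.comp_apply, liftEquiv_apply] using hp)) hSp (hasMaj_projO_comp (liftBlk blk ι) hX (some (Sum.inl μ)))
  have t2 := hasMaj_sandwich_localize blk (ψ := fgrad n (liftEquiv (τ μ) ι) (fun p : X × ι => χX p.1)) hK hcχ
    (fun p => by simpa only [fgrad_apply, liftEquiv_apply] using hdχ μ p.1) hχp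
    (fun p hp => by
      by_contra hnot
      have h1 : χX (τ μ p.1) = 0 := by by_contra h; exact hnot (hSτ p.1 h)
      have h2 : χX p.1 = 0 := by by_contra h; exact hnot (hS p.1 h)
      exact hp (by simp only [fgrad_apply, liftEquiv_apply, h1, h2, sub_self, mul_zero]))
    hSp (hasMaj_projO_comp (liftBlk blk ι) hX none)
  rw [fgrad_comp_cubeInv_sub_speciesOpM_eq τ n χX C A Δ hunit₀ hunit μ]
  refine (t1.add t2).mono fun y y' => le_of_eq ?_
  ring

/-- ★★ **ENTRY 1 (backward)**: `∇⁻_μ∘cubeInv (Δ − V(c, a)) χ ≤ 1_S(y)1_S(y′)·(1 + c_χ)·β(1 − βRc_r)⁻¹·e^{−ρd}` (`supp χ_X∘τ_μ⁻¹` over `S`). [cite: Balaban1984PropagatorsII, (2.133) p.247 (shape); Balaban1985BackgroundPropagators, (3.62)–(3.65) pp.402–403 (mechanism)] -/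
theorem hasMaj_bgrad_comp_cubeInv_sub_speciesOpM (htri : Triangle254 g) (hd : ∀ a b : g.Site, 0 ≤ g.dist a b) (hrow : RowSum g σ cr) (hσ : 0 ≤ σ) {ρ δ β rC rA cχ : ℝ}
    (hρ : 0 ≤ ρ) (hρδ : ρ + σ ≤ δ) (hβ : 0 ≤ β) (hrC : 0 ≤ rC) (hrA : 0 ≤ rA) (hcχ : 0 ≤ cχ) {S : Set g.Site} (hχ : ∀ x, |χX x| ≤ 1)
    (hdχ : ∀ μ x, |fgrad n (τ μ) χX x| ≤ cχ) (hdχb : ∀ μ x, |bgrad n (τ μ) χX x| ≤ cχ) (hS : ∀ x, χX x ≠ 0 → blk x ∈ S) (μ : J) (hSτ : ∀ x, χX ((τ μ).symm x) ≠ 0 → blk x ∈ S)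
    (hC : ∀ x i, ∑ k, |C x i k| ≤ rC) (hA : ∀ j x i, ∑ k, |A j x i k| ≤ rA) (hunit₀ : IsUnit (LinearMap.toMatrix' (dirOp Δ (fun p : X × ι => χX p.1))))
    (hN : HasMaj (BlockNorm.ofBlocks g (liftBlk blk ι)) (BlockNorm.ofBlocks g (liftBlk blk ι)) (cubeRes Δ (fun p : X × ι => χX p.1)) (fun y y' => β * Real.exp (-(δ * g.dist y y'))))
    (hDN : ∀ μ, HasMaj (BlockNorm.ofBlocks g (liftBlk blk ι)) (BlockNorm.ofBlocks g (liftBlk blk ι)) (fgrad n (liftEquiv (τ μ) ι) ∘ₗ cubeRes Δ (fun p : X × ι => χX p.1))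
      (fun y y' => β * Real.exp (-(δ * g.dist y y'))))
    (hDNb : ∀ μ, HasMaj (BlockNorm.ofBlocks g (liftBlk blk ι)) (BlockNorm.ofBlocks g (liftBlk blk ι)) (bgrad n (liftEquiv (τ μ) ι) ∘ₗ cubeRes Δ (fun p : X × ι => χX p.1))
      (fun y y' => β * Real.exp (-(δ * g.dist y y'))))
    (hq : β * ((rC + rA + Fintype.card J * (2 * (cχ * rA))) * (1 + Fintype.card (J ⊕ J))) * cr < 1) :
    HasMaj (BlockNorm.ofBlocks g (liftBlk blk ι)) (BlockNorm.ofBlocks g (liftBlk blk ι)) (bgrad n (liftEquiv (τ μ) ι) ∘ₗ cubeInv (Δ - speciesOpM τ n C A) (fun p : X × ι => χX p.1))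
      (fun y y' => ind S y * ind S y' * ((1 + cχ) * (β * (1 - β * ((rC + rA + Fintype.card J * (2 * (cχ * rA))) * (1 + Fintype.card (J ⊕ J))) * cr)⁻¹) * Real.exp (-(ρ * g.dist y y')))) := by
  obtain ⟨hunit, hX⟩ := hasMaj_bgPairM_cmpr blk τ n χX C A Δ htri hd hrow hσ hρ hρδ hβ hrC hrA hcχ hχ hdχ hdχb hC hA hN hDN hDNb hq
  have hβX : 0 ≤ β * (1 - β * ((rC + rA + Fintype.card J * (2 * (cχ * rA))) * (1 + Fintype.card (J ⊕ J))) * cr)⁻¹ :=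
    mul_nonneg hβ (inv_nonneg.2 (by linarith))
  have hK : ∀ a b : g.Site, 0 ≤ β * (1 - β * ((rC + rA + Fintype.card J * (2 * (cχ * rA))) * (1 + Fintype.card (J ⊕ J))) * cr)⁻¹ * Real.exp (-(ρ * g.dist a b)) :=
    fun a b => mul_nonneg hβX (Real.exp_nonneg _)
  have hχp : ∀ p : X × ι, |(fun p : X × ι => χX p.1) p| ≤ 1 := fun p => hχ p.1
  have hSp : ∀ p : X × ι, (fun p : X × ι => χX p.1) p ≠ 0 → blk p.1 ∈ S := fun p hp => hS p.1 hp
  have t1 := hasMaj_sandwich_localize blk (ψ := (fun p : X × ι => χX p.1) ∘ ⇑(liftEquiv (τ μ) ι).symm) hK zero_le_one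
    (fun p => by simpa only [Function.comp_apply, liftEquiv_symm_apply] using hχ ((τ μ).symm p.1)) hχp
    (fun p hp => hSτ p.1 (by simpa only [Function.comp_apply, liftEquiv_symm_apply] using hp)) hSp (hasMaj_projO_comp (liftBlk blk ι) hX (some (Sum.inr μ)))
  have t2 := hasMaj_sandwich_localize blk (ψ := bgrad n (liftEquiv (τ μ) ι) (fun p : X × ι => χX p.1)) hK hcχ
    (fun p => by simpa only [bgrad_apply, liftEquiv_symm_apply] using hdχb μ p.1) hχp
    (fun p hp => by
      by_contra hnot
      have h1 : χX ((τ μ).symm p.1) = 0 := by by_contra h; exact hnot (hSτ p.1 h)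
      have h2 : χX p.1 = 0 := by by_contra h; exact hnot (hS p.1 h)
      exact hp (by simp only [bgrad_apply, liftEquiv_symm_apply, h1, h2, sub_self, mul_zero]))
    hSp (hasMaj_projO_comp (liftBlk blk ι) hX none)
  rw [bgrad_comp_cubeInv_sub_speciesOpM_eq τ n χX C A Δ hunit₀ hunit μ]
  refine (t1.add t2).mono fun y y' => le_of_eq ?_
  ring

end Rows

/-! ## §3 By name at Bałaban's operator: the Dirichlet cube propagator of `Δ_U + W` at a live background -/

section Covariant

variable (η : ℝ) (U : J ⊕ J → X → Matrix ι ι ℝ) (W : (X × ι → ℝ) →ₗ[ℝ] (X × ι → ℝ))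

omit [Fintype X] [DecidableEq X] [DecidableEq J] in
/-- `Δ_U + W = lapOp η⁻¹ (liftEquiv∘τ) W − V(c_U, a_U)` — file 13's `covLapM_eq_lapOp` with the further summand `W` moved into FILE 46's Laplacian-type operator.
[cite: Balaban1985BackgroundPropagators, (3.50)–(3.53) p.400, (3.26) p.395 (shapes)] -/
theorem covLapM_add_eq_lapOp_sub :
    covLapM τ η U + W = lapOp η⁻¹ (fun μ => liftEquiv (τ μ) ι) W - speciesOpM τ η⁻¹ (tCoefC η U) (tCoefA η U) := by
  rw [covLapM_eq_lapOp, lapOp, lapOp]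
  abel

/-- ★★★ **ENTRY 0 OF THE DIRICHLET CUBE PROPAGATOR OF `Δ_U + W` AT A LIVE BACKGROUND `U`** (dag-n15-c FILE 55's per-cube row `hG`, one grid): from the FLAT cube resolvent
`N_□ = cubeRes (lapOp η⁻¹ (liftEquiv∘τ) W) χ` with entries `N_□, ∇^±N_□ ≤ βe^{−δd}` (`dirOp … χ` a unit), an idempotent ι-constant cut-off over `S` with `|χ_X| ≤ 1`, `|∇^±χ_X| ≤ c_χ`, the transport
rows `Σ_k|c_U(x)_{ik}| ≤ r_c`, `Σ_k|a_U{}^±(x)_{ik}| ≤ r_a` (the (3.35)–(3.37)-shaped letters of the cube's gauge), `R = (r_c + r_a + 2|J|c_χr_a)(1 + |J ⊕ J|)`, `ρ + σ ≤ δ`, `βRc_r < 1`: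
`cubeInv (Δ_U + W) χ ≤ 1_S(y)1_S(y′)·β(1 − βRc_r)⁻¹·e^{−ρd}`. [cite: Balaban1985BackgroundPropagators, p.399 («expanding with respect to A»), (3.50)–(3.53) p.400; Balaban1984PropagatorsII, (2.133) p.247 (shape)] -/
theorem hasMaj_cubeInv_covLapM_add (htri : Triangle254 g) (hd : ∀ a b : g.Site, 0 ≤ g.dist a b) (hrow : RowSum g σ cr) (hσ : 0 ≤ σ) {ρ δ β rC rA cχ : ℝ} (hρ : 0 ≤ ρ)
    (hρδ : ρ + σ ≤ δ) (hβ : 0 ≤ β) (hrC : 0 ≤ rC) (hrA : 0 ≤ rA) (hcχ : 0 ≤ cχ) {S : Set g.Site} (hχ2 : χX * χX = χX) (hχ : ∀ x, |χX x| ≤ 1)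
    (hdχ : ∀ μ x, |fgrad η⁻¹ (τ μ) χX x| ≤ cχ) (hdχb : ∀ μ x, |bgrad η⁻¹ (τ μ) χX x| ≤ cχ) (hS : ∀ x, χX x ≠ 0 → blk x ∈ S) (hC : ∀ x i, ∑ k, |tCoefC η U x i k| ≤ rC)
    (hA : ∀ j x i, ∑ k, |tCoefA η U j x i k| ≤ rA) (hunit₀ : IsUnit (LinearMap.toMatrix' (dirOp (lapOp η⁻¹ (fun μ => liftEquiv (τ μ) ι) W) (fun p : X × ι => χX p.1))))
    (hN : HasMaj (BlockNorm.ofBlocks g (liftBlk blk ι)) (BlockNorm.ofBlocks g (liftBlk blk ι)) (cubeRes (lapOp η⁻¹ (fun μ => liftEquiv (τ μ) ι) W) (fun p : X × ι => χX p.1))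
      (fun y y' => β * Real.exp (-(δ * g.dist y y'))))
    (hDN : ∀ μ, HasMaj (BlockNorm.ofBlocks g (liftBlk blk ι)) (BlockNorm.ofBlocks g (liftBlk blk ι))
      (fgrad η⁻¹ (liftEquiv (τ μ) ι) ∘ₗ cubeRes (lapOp η⁻¹ (fun μ => liftEquiv (τ μ) ι) W) (fun p : X × ι => χX p.1)) (fun y y' => β * Real.exp (-(δ * g.dist y y'))))
    (hDNb : ∀ μ, HasMaj (BlockNorm.ofBlocks g (liftBlk blk ι)) (BlockNorm.ofBlocks g (liftBlk blk ι))
      (bgrad η⁻¹ (liftEquiv (τ μ) ι) ∘ₗ cubeRes (lapOp η⁻¹ (fun μ => liftEquiv (τ μ) ι) W) (fun p : X × ι => χX p.1)) (fun y y' => β * Real.exp (-(δ * g.dist y y'))))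
    (hq : β * ((rC + rA + Fintype.card J * (2 * (cχ * rA))) * (1 + Fintype.card (J ⊕ J))) * cr < 1) :
    HasMaj (BlockNorm.ofBlocks g (liftBlk blk ι)) (BlockNorm.ofBlocks g (liftBlk blk ι)) (cubeInv (covLapM τ η U + W) (fun p : X × ι => χX p.1))
      (fun y y' => ind S y * ind S y' * (β * (1 - β * ((rC + rA + Fintype.card J * (2 * (cχ * rA))) * (1 + Fintype.card (J ⊕ J))) * cr)⁻¹ * Real.exp (-(ρ * g.dist y y')))) := by
  rw [covLapM_add_eq_lapOp_sub]
  exact hasMaj_cubeInv_sub_speciesOpM blk τ η⁻¹ χX (tCoefC η U) (tCoefA η U) _ htri hd hrow hσ hρ hρδ hβ hrC hrA hcχ hχ2 hχ hdχ hdχb hS hC hA hunit₀ hN hDN hDNb hq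

/-- ★★ **ENTRY 1 (forward) OF THE DIRICHLET CUBE PROPAGATOR OF `Δ_U + W` AT A LIVE BACKGROUND** (FILE 55's `hD`, one grid): `∇⁺_μ∘cubeInv (Δ_U + W) χ ≤ 1_S1_S·(1 + c_χ)β(1 − βRc_r)⁻¹e^{−ρd}`
(same data; `supp χ_X∘τ_μ` over `S`). [cite: Balaban1984PropagatorsII, (2.133) p.247 («|(∇G_□J)(x)|»: shape); Balaban1985BackgroundPropagators, p.399, (3.50)–(3.53) p.400] -/
theorem hasMaj_fgrad_comp_cubeInv_covLapM_add (htri : Triangle254 g) (hd : ∀ a b : g.Site, 0 ≤ g.dist a b) (hrow : RowSum g σ cr) (hσ : 0 ≤ σ) {ρ δ β rC rA cχ : ℝ}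
    (hρ : 0 ≤ ρ) (hρδ : ρ + σ ≤ δ) (hβ : 0 ≤ β) (hrC : 0 ≤ rC) (hrA : 0 ≤ rA) (hcχ : 0 ≤ cχ) {S : Set g.Site} (hχ : ∀ x, |χX x| ≤ 1)
    (hdχ : ∀ μ x, |fgrad η⁻¹ (τ μ) χX x| ≤ cχ) (hdχb : ∀ μ x, |bgrad η⁻¹ (τ μ) χX x| ≤ cχ) (hS : ∀ x, χX x ≠ 0 → blk x ∈ S) (μ : J) (hSτ : ∀ x, χX (τ μ x) ≠ 0 → blk x ∈ S)
    (hC : ∀ x i, ∑ k, |tCoefC η U x i k| ≤ rC) (hA : ∀ j x i, ∑ k, |tCoefA η U j x i k| ≤ rA)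
    (hunit₀ : IsUnit (LinearMap.toMatrix' (dirOp (lapOp η⁻¹ (fun μ => liftEquiv (τ μ) ι) W) (fun p : X × ι => χX p.1))))
    (hN : HasMaj (BlockNorm.ofBlocks g (liftBlk blk ι)) (BlockNorm.ofBlocks g (liftBlk blk ι)) (cubeRes (lapOp η⁻¹ (fun μ => liftEquiv (τ μ) ι) W) (fun p : X × ι => χX p.1))
      (fun y y' => β * Real.exp (-(δ * g.dist y y'))))
    (hDN : ∀ μ, HasMaj (BlockNorm.ofBlocks g (liftBlk blk ι)) (BlockNorm.ofBlocks g (liftBlk blk ι))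
      (fgrad η⁻¹ (liftEquiv (τ μ) ι) ∘ₗ cubeRes (lapOp η⁻¹ (fun μ => liftEquiv (τ μ) ι) W) (fun p : X × ι => χX p.1)) (fun y y' => β * Real.exp (-(δ * g.dist y y'))))
    (hDNb : ∀ μ, HasMaj (BlockNorm.ofBlocks g (liftBlk blk ι)) (BlockNorm.ofBlocks g (liftBlk blk ι))
      (bgrad η⁻¹ (liftEquiv (τ μ) ι) ∘ₗ cubeRes (lapOp η⁻¹ (fun μ => liftEquiv (τ μ) ι) W) (fun p : X × ι => χX p.1)) (fun y y' => β * Real.exp (-(δ * g.dist y y'))))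
    (hq : β * ((rC + rA + Fintype.card J * (2 * (cχ * rA))) * (1 + Fintype.card (J ⊕ J))) * cr < 1) :
    HasMaj (BlockNorm.ofBlocks g (liftBlk blk ι)) (BlockNorm.ofBlocks g (liftBlk blk ι)) (fgrad η⁻¹ (liftEquiv (τ μ) ι) ∘ₗ cubeInv (covLapM τ η U + W) (fun p : X × ι => χX p.1))
      (fun y y' => ind S y * ind S y' * ((1 + cχ) * (β * (1 - β * ((rC + rA + Fintype.card J * (2 * (cχ * rA))) * (1 + Fintype.card (J ⊕ J))) * cr)⁻¹) * Real.exp (-(ρ * g.dist y y')))) := by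
  rw [covLapM_add_eq_lapOp_sub]
  exact hasMaj_fgrad_comp_cubeInv_sub_speciesOpM blk τ η⁻¹ χX (tCoefC η U) (tCoefA η U) _ htri hd hrow hσ hρ hρδ hβ hrC hrA hcχ hχ hdχ hdχb hS μ hSτ hC hA hunit₀ hN hDN hDNb hq

/-- ★★ **ENTRY 1 (backward)** (FILE 55's `hDb`, one grid): `∇⁻_μ∘cubeInv (Δ_U + W) χ ≤ 1_S1_S·(1 + c_χ)β(1 − βRc_r)⁻¹e^{−ρd}` (`supp χ_X∘τ_μ⁻¹` over `S`).
[cite: Balaban1984PropagatorsII, (2.133) p.247 (shape); Balaban1985BackgroundPropagators, p.399, (3.50)–(3.53) p.400] -/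
theorem hasMaj_bgrad_comp_cubeInv_covLapM_add (htri : Triangle254 g) (hd : ∀ a b : g.Site, 0 ≤ g.dist a b) (hrow : RowSum g σ cr) (hσ : 0 ≤ σ) {ρ δ β rC rA cχ : ℝ}
    (hρ : 0 ≤ ρ) (hρδ : ρ + σ ≤ δ) (hβ : 0 ≤ β) (hrC : 0 ≤ rC) (hrA : 0 ≤ rA) (hcχ : 0 ≤ cχ) {S : Set g.Site} (hχ : ∀ x, |χX x| ≤ 1)
    (hdχ : ∀ μ x, |fgrad η⁻¹ (τ μ) χX x| ≤ cχ) (hdχb : ∀ μ x, |bgrad η⁻¹ (τ μ) χX x| ≤ cχ) (hS : ∀ x, χX x ≠ 0 → blk x ∈ S) (μ : J) (hSτ : ∀ x, χX ((τ μ).symm x) ≠ 0 → blk x ∈ S)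
    (hC : ∀ x i, ∑ k, |tCoefC η U x i k| ≤ rC) (hA : ∀ j x i, ∑ k, |tCoefA η U j x i k| ≤ rA)
    (hunit₀ : IsUnit (LinearMap.toMatrix' (dirOp (lapOp η⁻¹ (fun μ => liftEquiv (τ μ) ι) W) (fun p : X × ι => χX p.1))))
    (hN : HasMaj (BlockNorm.ofBlocks g (liftBlk blk ι)) (BlockNorm.ofBlocks g (liftBlk blk ι)) (cubeRes (lapOp η⁻¹ (fun μ => liftEquiv (τ μ) ι) W) (fun p : X × ι => χX p.1))
      (fun y y' => β * Real.exp (-(δ * g.dist y y'))))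
    (hDN : ∀ μ, HasMaj (BlockNorm.ofBlocks g (liftBlk blk ι)) (BlockNorm.ofBlocks g (liftBlk blk ι))
      (fgrad η⁻¹ (liftEquiv (τ μ) ι) ∘ₗ cubeRes (lapOp η⁻¹ (fun μ => liftEquiv (τ μ) ι) W) (fun p : X × ι => χX p.1)) (fun y y' => β * Real.exp (-(δ * g.dist y y'))))
    (hDNb : ∀ μ, HasMaj (BlockNorm.ofBlocks g (liftBlk blk ι)) (BlockNorm.ofBlocks g (liftBlk blk ι))
      (bgrad η⁻¹ (liftEquiv (τ μ) ι) ∘ₗ cubeRes (lapOp η⁻¹ (fun μ => liftEquiv (τ μ) ι) W) (fun p : X × ι => χX p.1)) (fun y y' => β * Real.exp (-(δ * g.dist y y'))))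
    (hq : β * ((rC + rA + Fintype.card J * (2 * (cχ * rA))) * (1 + Fintype.card (J ⊕ J))) * cr < 1) :
    HasMaj (BlockNorm.ofBlocks g (liftBlk blk ι)) (BlockNorm.ofBlocks g (liftBlk blk ι)) (bgrad η⁻¹ (liftEquiv (τ μ) ι) ∘ₗ cubeInv (covLapM τ η U + W) (fun p : X × ι => χX p.1))
      (fun y y' => ind S y * ind S y' * ((1 + cχ) * (β * (1 - β * ((rC + rA + Fintype.card J * (2 * (cχ * rA))) * (1 + Fintype.card (J ⊕ J))) * cr)⁻¹) * Real.exp (-(ρ * g.dist y y')))) := by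
  rw [covLapM_add_eq_lapOp_sub]
  exact hasMaj_bgrad_comp_cubeInv_sub_speciesOpM blk τ η⁻¹ χX (tCoefC η U) (tCoefA η U) _ htri hd hrow hσ hρ hρδ hβ hrC hrA hcχ hχ hdχ hdχb hS μ hSτ hC hA hunit₀ hN hDN hDNb hq

end Covariant

end Summit.QuantumFields.YangMills.BalabanUVNodes.N15.CurvedSpecies

end
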